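import Literature.MathematicalPhysics.KineticTheory.DiPernaLionsCollisionTerms
import HarnessLib

/-!
# The smooth concave truncations `βₘ(y) = m (1 - e^{-y/m})` of the DiPerna–Lions stability proof

Topic: MathematicalPhysics / KineticTheory. Infrastructure for the named fact (L12)
`diPernaLions_limit_expDuhamel` (Cercignani–Illner–Pulvirenti 1994 §5.3 Lemma 5.3.12). In the
supersolution half of the proof of Lemma 5.3.12 (p. 158) CIP truncate the approximate solutions by
`βₘ(t) = min(t, m)`, "`gₘⁿ := βₘ ∘ fⁿ ⇀ gₘ`, and, by (3.34), `gₘ → f` strongly and monotone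
increasing in `L¹`"; Lemma 5.3.10 (p. 155) allows any family of uniformly Lipschitz
renormalisations `β_δ` with `β_δ(0) = 0`, `β_δ(s) → s`. For the formal proof a *smooth* member of
this class is more convenient (the chain rule `T β(fⁿ) = β'(fⁿ) T fⁿ` is then classical, cf.
`IsDiPernaLionsApproximateSolution.renormalised_expForm`): this file records the exponential
truncations `expTrunc m y = m (1 - e^{-y/m})` and their elementary properties. Everything is
proved; one definition, theorems otherwise.

* `expTrunc m` is smooth, `0 ≤ βₘ(y) ≤ min(y, m)` for `y ≥ 0`, nondecreasing and concave in `y`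
  (`monotone_expTrunc`, `concaveOn_expTrunc`),
  nondecreasing in `m` (`expTrunc_mono_left`, the monotonicity behind "`gₘ ↗`"), with
  `βₘ'(y) = e^{-y/m} ∈ (0, 1]` and `βₘ'(y) (1 + y) ≤ max m 1` (so that `|βₘ'(fⁿ) Q̃±ⁿ(fⁿ,fⁿ)|` is
  dominated by the normalised terms `Q̃±ⁿ/(1 + fⁿ)` of CIP Lemma 5.3.7);
* `self_sub_expTrunc_le`: `0 ≤ y - βₘ(y) ≤ y²/(2m)` (from `e^{-u} ≤ 1 - u + u²/2`), hence
  `βₘ(y) → y`; `self_sub_expTrunc_le_weight` and `lintegral_sub_expTrunc_le`: the integrated form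
  of (3.34) under the mass–moment–entropy bound,
  `∫∫ (g - βₘ(g)) ≤ (M/(2m) + (log M)⁻¹) C` for every `M > 1` (as `lintegral_sub_logTrunc_le` for
  `β_δ = δ⁻¹ log(1 + δ·)`).

## References

* C. Cercignani, R. Illner, M. Pulvirenti, *The Mathematical Theory of Dilute Gases*, Springer
  (1994), §5.3 Lemma 5.3.10 and (3.34) (p. 155), proof of Lemma 5.3.12 (p. 158).
-/

open MeasureTheory Metric Real Set Filter Topology
open scoped InnerProductSpace ENNReal

noncomputable section

namespace Literature.MathematicalPhysics.KineticTheory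

/-! ## The truncation and its pointwise properties -/

section Pointwise

/-- The smooth concave truncation `βₘ(y) = m (1 - e^{-y/m})` at height `m` (a smooth member of
the class of renormalisations of CIP 1994 Lemma 5.3.10: Lipschitz, `β(0) = 0`, `βₘ(y) → y` as
`m → ∞`; used in place of `min(y, m)` of the proof of Lemma 5.3.12). [cite: CIPDiluteGases1994, §5.3 Lemma 5.3.10 (p. 155)] -/
def expTrunc (m y : ℝ) : ℝ := m * (1 - exp (-y / m))

/-- `βₘ(0) = 0`. [folklore] -/
@[simp]
theorem expTrunc_zero_right (m : ℝ) : expTrunc m 0 = 0 := by simp [expTrunc]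

/-- `βₘ(y) ≥ 0` for `m > 0`, `y ≥ 0`. [folklore] -/
theorem expTrunc_nonneg {m y : ℝ} (hm : 0 < m) (hy : 0 ≤ y) : 0 ≤ expTrunc m y := by
  unfold expTrunc
  refine mul_nonneg hm.le (sub_nonneg.2 (exp_le_one_iff.2 ?_))
  exact div_nonpos_of_nonpos_of_nonneg (neg_nonpos.2 hy) hm.le

/-- `βₘ(y) > 0` for `m > 0`, `y > 0`. [folklore] -/
theorem expTrunc_pos {m y : ℝ} (hm : 0 < m) (hy : 0 < y) : 0 < expTrunc m y := by
  unfold expTrunc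
  refine mul_pos hm (sub_pos.2 (exp_lt_one_iff.2 ?_))
  exact div_neg_of_neg_of_pos (neg_neg_of_pos hy) hm

/-- `βₘ(y) ≤ m` for `m > 0`. [folklore] -/
theorem expTrunc_le_left {m : ℝ} (hm : 0 < m) (y : ℝ) : expTrunc m y ≤ m := by
  unfold expTrunc
  have : 0 < exp (-y / m) := exp_pos _
  nlinarith

/-- `βₘ(y) ≤ y` for `m > 0` (from `1 - s ≤ e^{-s}`). [folklore] -/
theorem expTrunc_le_self {m : ℝ} (hm : 0 < m) (y : ℝ) : expTrunc m y ≤ y := by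
  unfold expTrunc
  have h := add_one_le_exp (-(y / m))
  have h' : -y / m = -(y / m) := neg_div m y
  rw [h']
  have : m * (1 - exp (-(y / m))) ≤ m * (y / m) := mul_le_mul_of_nonneg_left (by linarith) hm.le
  calc m * (1 - exp (-(y / m))) ≤ m * (y / m) := this
    _ = y := by field_simp

/-- The derivative `βₘ'(y) = e^{-y/m}` (`m ≠ 0`). [folklore] -/
theorem hasDerivAt_expTrunc {m : ℝ} (hm : m ≠ 0) (y : ℝ) :
    HasDerivAt (expTrunc m) (exp (-y / m)) y := by
  unfold expTrunc
  have h1 : HasDerivAt (fun y : ℝ => -y / m) (-1 / m) y := by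
    simpa using ((hasDerivAt_id y).neg).div_const m
  have h2 := (h1.exp).const_sub 1
  have h3 := h2.const_mul m
  refine h3.congr_deriv ?_
  field_simp

/-- `βₘ` is differentiable. [folklore] -/
theorem differentiable_expTrunc {m : ℝ} (hm : m ≠ 0) : Differentiable ℝ (expTrunc m) :=
  fun y => (hasDerivAt_expTrunc hm y).differentiableAt

/-- `βₘ` is continuous. [folklore] -/
theorem continuous_expTrunc (m : ℝ) : Continuous (expTrunc m) := by
  unfold expTrunc
  fun_prop

/-- `βₘ` is Borel measurable. [folklore] -/
theorem measurable_expTrunc (m : ℝ) : Measurable (expTrunc m) :=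
  (continuous_expTrunc m).measurable

/-- `deriv βₘ = e^{-·/m}`. [folklore] -/
theorem deriv_expTrunc {m : ℝ} (hm : m ≠ 0) (y : ℝ) : deriv (expTrunc m) y = exp (-y / m) :=
  (hasDerivAt_expTrunc hm y).deriv

/-- `0 < βₘ'(y) ≤ 1` for `m > 0`, `y ≥ 0`. [folklore] -/
theorem exp_neg_div_pos_and_le_one {m y : ℝ} (hm : 0 < m) (hy : 0 ≤ y) :
    0 < exp (-y / m) ∧ exp (-y / m) ≤ 1 :=
  ⟨exp_pos _, exp_le_one_iff.2 (div_nonpos_of_nonpos_of_nonneg (neg_nonpos.2 hy) hm.le)⟩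

/-- `βₘ` is nondecreasing (for `m > 0`). [folklore] -/
theorem monotone_expTrunc {m : ℝ} (hm : 0 < m) : Monotone (expTrunc m) :=
  monotone_of_deriv_nonneg (differentiable_expTrunc hm.ne') fun y => by
    rw [deriv_expTrunc hm.ne']; exact (exp_pos _).le

/-- `βₘ` is concave for `m > 0` (its derivative `e^{-y/m}` is nonincreasing). [folklore] -/
theorem concaveOn_expTrunc {m : ℝ} (hm : 0 < m) : ConcaveOn ℝ univ (expTrunc m) := by
  refine AntitoneOn.concaveOn_of_deriv convex_univ (continuous_expTrunc m).continuousOn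
    (differentiable_expTrunc hm.ne').differentiableOn fun a _ b _ hab => ?_
  rw [deriv_expTrunc hm.ne', deriv_expTrunc hm.ne']
  refine exp_le_exp.2 ?_
  rw [neg_div, neg_div]
  exact neg_le_neg (div_le_div_of_nonneg_right hab hm.le)

/-- **The derivative weight is dominated by the renormalising factor**:
`βₘ'(y) (1 + y) = e^{-y/m} (1 + y) ≤ max m 1` for `m > 0`, `y ≥ 0` (so that
`|βₘ'(fⁿ) Q±| ≤ max m 1 · Q±/(1 + fⁿ)`). [folklore] -/
theorem exp_neg_div_mul_one_add_le {m y : ℝ} (hm : 0 < m) (hy : 0 ≤ y) :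
    exp (-y / m) * (1 + y) ≤ max m 1 := by
  -- `e^{-y/m} ≤ m/(m+y)` from `1 + y/m ≤ e^{y/m}`
  have h1 : exp (-y / m) ≤ m / (m + y) := by
    have h := add_one_le_exp (y / m)
    have hpos : 0 < y / m + 1 := by positivity
    rw [show -y / m = -(y / m) by ring, exp_neg, inv_eq_one_div, div_le_div_iff₀ (exp_pos _) (by positivity)]
    calc 1 * (m + y) = m * (y / m + 1) := by field_simp; ring
      _ ≤ m * exp (y / m) := mul_le_mul_of_nonneg_left h hm.le
  have h2 : m / (m + y) * (1 + y) ≤ max m 1 := by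
    rw [div_mul_eq_mul_div, div_le_iff₀ (by positivity)]
    rcases le_total 1 m with hm1 | hm1
    · rw [max_eq_left hm1]; nlinarith
    · rw [max_eq_right hm1]; nlinarith
  calc exp (-y / m) * (1 + y) ≤ m / (m + y) * (1 + y) :=
        mul_le_mul_of_nonneg_right h1 (by linarith)
    _ ≤ max m 1 := h2

/-- `e^{-u} ≤ 1 - u + u²/2` for `u ≥ 0`. [folklore] -/
theorem exp_neg_le_one_sub_add_sq_div_two {u : ℝ} (hu : 0 ≤ u) :
    exp (-u) ≤ 1 - u + u ^ 2 / 2 := by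
  let g : ℝ → ℝ := fun u => 1 - u + u * u / 2 - exp (-u)
  have hg : ∀ u, HasDerivAt g (-1 + u + exp (-u)) u := by
    intro u
    have h1 : HasDerivAt (fun u : ℝ => 1 - u + u * u / 2) (0 - 1 + (1 * u + u * 1) / 2) u :=
      ((hasDerivAt_const u 1).sub (hasDerivAt_id u)).add
        (((hasDerivAt_id u).mul (hasDerivAt_id u)).div_const 2)
    have h2 : HasDerivAt (fun u : ℝ => exp (-u)) (exp (-u) * -1) u := (hasDerivAt_id u).neg.exp
    refine (h1.sub h2).congr_deriv ?_
    ring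
  have hmono : MonotoneOn g (Ici 0) :=
    monotoneOn_of_deriv_nonneg (convex_Ici 0) (fun u _ => (hg u).continuousAt.continuousWithinAt)
      (fun u _ => (hg u).differentiableAt.differentiableWithinAt) fun u _ => by
        rw [(hg u).deriv]
        linarith [add_one_le_exp (-u)]
  have h0 : g 0 ≤ g u := hmono (self_mem_Ici) hu hu
  have hg0 : g 0 = 0 := by simp [g]
  rw [hg0] at h0
  simp only [g] at h0
  nlinarith [h0]

/-- **`0 ≤ y - βₘ(y) ≤ y²/(2m)`** for `m > 0`, `y ≥ 0`. [folklore] -/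
theorem self_sub_expTrunc_le {m y : ℝ} (hm : 0 < m) (hy : 0 ≤ y) :
    y - expTrunc m y ≤ y ^ 2 / (2 * m) := by
  unfold expTrunc
  have h := exp_neg_le_one_sub_add_sq_div_two (u := y / m) (div_nonneg hy hm.le)
  rw [show -y / m = -(y / m) by ring]
  have : m * exp (-(y / m)) ≤ m * (1 - y / m + (y / m) ^ 2 / 2) := mul_le_mul_of_nonneg_left h hm.le
  have hid : m * (1 - y / m + (y / m) ^ 2 / 2) = m - y + y ^ 2 / (2 * m) := by
    field_simp
  nlinarith [this, hid]

/-- `y - βₘ(y) ≤ y · min(1, y/(2m))` for `m > 0`, `y ≥ 0`. [folklore] -/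
theorem self_sub_expTrunc_le_min {m y : ℝ} (hm : 0 < m) (hy : 0 ≤ y) :
    y - expTrunc m y ≤ y * min 1 (y / (2 * m)) := by
  rcases le_total 1 (y / (2 * m)) with h | h
  · rw [min_eq_left h, mul_one]
    linarith [expTrunc_nonneg hm hy]
  · rw [min_eq_right h]
    have := self_sub_expTrunc_le hm hy
    calc y - expTrunc m y ≤ y ^ 2 / (2 * m) := this
      _ = y * (y / (2 * m)) := by ring

/-- **`βₘ(y) → y` as `m → ∞`** (`y ≥ 0`). [folklore] -/
theorem tendsto_expTrunc_atTop {y : ℝ} (hy : 0 ≤ y) :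
    Tendsto (fun m => expTrunc m y) atTop (𝓝 y) := by
  have hlow : ∀ᶠ m in atTop, y - y ^ 2 / (2 * m) ≤ expTrunc m y := by
    filter_upwards [eventually_gt_atTop 0] with m hm
    linarith [self_sub_expTrunc_le hm hy]
  have hup : ∀ᶠ m in atTop, expTrunc m y ≤ y := by
    filter_upwards [eventually_gt_atTop 0] with m hm
    exact expTrunc_le_self hm y
  have hlim : Tendsto (fun m : ℝ => y - y ^ 2 / (2 * m)) atTop (𝓝 y) := by
    have : Tendsto (fun m : ℝ => y ^ 2 / (2 * m)) atTop (𝓝 0) := by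
      have h := (tendsto_const_nhds : Tendsto (fun _ : ℝ => y ^ 2) atTop (𝓝 (y ^ 2))).div_atTop
        (tendsto_id.const_mul_atTop (show (0 : ℝ) < 2 by norm_num))
      simpa using h
    simpa using tendsto_const_nhds.sub this
  exact tendsto_of_tendsto_of_tendsto_of_le_of_le' hlim tendsto_const_nhds hlow hup

/-- **`βₘ(y)` is nondecreasing in `m`** on `(0, ∞)` for `y ≥ 0` (the derivative in `m` is
`1 - (1 + y/m) e^{-y/m} ≥ 0`): the truncations increase to the identity. [folklore] -/
theorem expTrunc_mono_left {m m' y : ℝ} (hm : 0 < m) (hmm' : m ≤ m') (hy : 0 ≤ y) :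
    expTrunc m y ≤ expTrunc m' y := by
  -- `φ(m) = m (1 - e^{-y/m})` is monotone on `(0, ∞)`
  have hderiv : ∀ m : ℝ, 0 < m → HasDerivAt (fun m => expTrunc m y)
      (1 - exp (-y / m) - y / m * exp (-y / m)) m := by
    intro m hm
    have h1 : HasDerivAt (fun m : ℝ => -y / m) (y / m ^ 2) m := by
      have := (hasDerivAt_inv hm.ne').const_mul (-y)
      refine this.congr_of_eventuallyEq ?_ |>.congr_deriv (by field_simp)
      exact Eventually.of_forall fun x => by simp [div_eq_mul_inv]
    have h2 : HasDerivAt (fun m : ℝ => 1 - exp (-y / m)) (-(exp (-y / m) * (y / m ^ 2))) m := by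
      simpa using (h1.exp).const_sub 1
    have h3 := (hasDerivAt_id m).mul h2
    refine h3.congr_deriv ?_
    simp only [id]
    field_simp
    ring
  have hmono : MonotoneOn (fun m => expTrunc m y) (Ici m) := by
    refine monotoneOn_of_deriv_nonneg (convex_Ici m) ?_ ?_ ?_
    · intro x hx
      exact (hderiv x (hm.trans_le hx)).continuousAt.continuousWithinAt
    · intro x hx
      rw [interior_Ici] at hx
      exact (hderiv x (hm.trans hx)).differentiableAt.differentiableWithinAt
    · intro x hx
      rw [interior_Ici] at hx
      have hx0 : 0 < x := hm.trans hx
      rw [(hderiv x hx0).deriv]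
      -- `(1 + u) e^{-u} ≤ 1`, `u = y/x ≥ 0`
      have hu : 0 ≤ y / x := div_nonneg hy hx0.le
      have h := add_one_le_exp (y / x)
      have hexp : exp (-y / x) = (exp (y / x))⁻¹ := by
        rw [show -y / x = -(y / x) by ring, exp_neg]
      rw [hexp]
      have hpos : 0 < exp (y / x) := exp_pos _
      rw [sub_sub, ← one_add_mul, ← div_eq_mul_inv, sub_nonneg, div_le_one hpos]
      linarith
  exact hmono (self_mem_Ici) hmm' hmm'

end Pointwise

/-! ## (3.34) for the exponential truncations -/

section Integrated

/-- Pointwise form of (3.34): `y - βₘ(y) ≤ (M/(2m) + (log M)⁻¹) · y (1 + w + |log y|)` for `y ≥ 0`,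
`w ≥ 0`, `M > 1`, `m > 0` (`y ≤ M`: `y²/(2m) ≤ (M/(2m)) y`; `y > M`: `y ≤ y |log y|/log M`).
[folklore] -/
theorem self_sub_expTrunc_le_weight {m y w M : ℝ} (hm : 0 < m) (hy : 0 ≤ y) (hw : 0 ≤ w)
    (hM : 1 < M) :
    y - expTrunc m y ≤ (M / (2 * m) + (log M)⁻¹) * (y * (1 + w + |log y|)) := by
  have hlM : 0 < log M := log_pos hM
  have hbase : y ≤ y * (1 + w + |log y|) :=
    le_mul_of_one_le_right hy (by nlinarith [abs_nonneg (log y)])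
  have hK1 : 0 ≤ M / (2 * m) := by positivity
  have hK2 : 0 ≤ (log M)⁻¹ := by positivity
  rcases le_or_gt y M with hyM | hyM
  · -- `y ≤ M`
    calc y - expTrunc m y ≤ y ^ 2 / (2 * m) := self_sub_expTrunc_le hm hy
      _ = y / (2 * m) * y := by ring
      _ ≤ M / (2 * m) * y := by
          refine mul_le_mul_of_nonneg_right (div_le_div_of_nonneg_right hyM (by positivity)) hy
      _ ≤ M / (2 * m) * (y * (1 + w + |log y|)) := mul_le_mul_of_nonneg_left hbase hK1
      _ ≤ (M / (2 * m) + (log M)⁻¹) * (y * (1 + w + |log y|)) := by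
          have : 0 ≤ (log M)⁻¹ * (y * (1 + w + |log y|)) := by positivity
          nlinarith
  · -- `y > M`
    have hly : log M ≤ log y := log_le_log (by linarith) hyM.le
    have hly' : log M ≤ |log y| := hly.trans (le_abs_self _)
    calc y - expTrunc m y ≤ y := by linarith [expTrunc_nonneg hm hy]
      _ ≤ (log M)⁻¹ * (y * (1 + w + |log y|)) := by
          rw [← div_le_iff₀' (inv_pos.2 hlM), div_inv_eq_mul]
          calc y * log M ≤ y * |log y| := mul_le_mul_of_nonneg_left hly' hy
            _ ≤ y * (1 + w + |log y|) := mul_le_mul_of_nonneg_left (by linarith) hy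
      _ ≤ (M / (2 * m) + (log M)⁻¹) * (y * (1 + w + |log y|)) := by
          have : 0 ≤ M / (2 * m) * (y * (1 + w + |log y|)) := by positivity
          nlinarith

variable {E : Type*} [NormedAddCommGroup E] [InnerProductSpace ℝ E] [FiniteDimensional ℝ E]
  [MeasurableSpace E] [BorelSpace E]

/-- **(3.34) for `βₘ`**: under the mass–moment–entropy bound `∫∫ g (1 + |x|² + |v|² + |log g|) ≤ C`,
`∫∫ (g - βₘ(g)) ≤ (M/(2m) + (log M)⁻¹) C` for every `M > 1` (CIP 1994 (3.34): "The weak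
compactness of `{fⁿ}` implies that `sup_n ‖fⁿ - β_δ(fⁿ)‖_{L¹} → 0` as `δ → 0`"; here with the
explicit rate coming from the uniform bounds (3.21)–(3.22)). [cite: CIPDiluteGases1994, §5.3 Lemma 5.3.10 (3.34) (p. 155)] -/
theorem lintegral_sub_expTrunc_le {g : E × E → ℝ} (hg : ∀ z, 0 ≤ g z) {C : ℝ}
    (hC : ∫⁻ z, ENNReal.ofReal (g z * (1 + ‖z.1‖ ^ 2 + ‖z.2‖ ^ 2 + |log (g z)|))
      ∂((volume : Measure E).prod volume) ≤ ENNReal.ofReal C)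
    {m M : ℝ} (hm : 0 < m) (hM : 1 < M) :
    ∫⁻ z, ENNReal.ofReal (g z - expTrunc m (g z)) ∂((volume : Measure E).prod volume) ≤
      ENNReal.ofReal ((M / (2 * m) + (log M)⁻¹) * C) := by
  have hK : 0 ≤ M / (2 * m) + (log M)⁻¹ := by
    have := log_pos hM; positivity
  calc ∫⁻ z, ENNReal.ofReal (g z - expTrunc m (g z)) ∂((volume : Measure E).prod volume)
      ≤ ∫⁻ z, ENNReal.ofReal (M / (2 * m) + (log M)⁻¹) *
          ENNReal.ofReal (g z * (1 + ‖z.1‖ ^ 2 + ‖z.2‖ ^ 2 + |log (g z)|))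
            ∂((volume : Measure E).prod volume) := by
        refine lintegral_mono fun z => ?_
        rw [← ENNReal.ofReal_mul hK]
        refine ENNReal.ofReal_le_ofReal ?_
        have := self_sub_expTrunc_le_weight hm (hg z) (w := ‖z.1‖ ^ 2 + ‖z.2‖ ^ 2) (by positivity) hM
        simpa [add_assoc] using this
    _ = ENNReal.ofReal (M / (2 * m) + (log M)⁻¹) *
          ∫⁻ z, ENNReal.ofReal (g z * (1 + ‖z.1‖ ^ 2 + ‖z.2‖ ^ 2 + |log (g z)|))
            ∂((volume : Measure E).prod volume) :=
        lintegral_const_mul' _ _ ENNReal.ofReal_ne_top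
    _ ≤ ENNReal.ofReal (M / (2 * m) + (log M)⁻¹) * ENNReal.ofReal C := mul_le_mul' le_rfl hC
    _ = ENNReal.ofReal ((M / (2 * m) + (log M)⁻¹) * C) := (ENNReal.ofReal_mul hK).symm

end Integrated

end Literature.MathematicalPhysics.KineticTheory
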